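import Summits.BirchSwinnertonDyer.Rank2.MuZeroAnchorAtTwoPlantedDoor
import Summits.BirchSwinnertonDyer.BirchSwinnertonDyer.Theorems.TwoAdicConverseKidaAnalytic
import Literature.NumberTheory.EllipticCurves.PAdicLFunctionIntegralityAtTwoAutoProofs
import Literature.NumberTheory.EllipticCurves.PAdicLFunctionRiemannSumCertificateProofs
import Literature.NumberTheory.EllipticCurves.PAdicLFunctionOrderTransferRankOneProofs
import Literature.NumberTheory.EllipticCurves.ModularCurvePeriodRatio
import Literature.NumberTheory.EllipticCurves.KatoRankBoundProofs
import Literature.NumberTheory.EllipticCurves.LeadingTermPPartEisensteinProofs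
import Literature.NumberTheory.EllipticCurves.IrreducibleModPQuadraticTwistProofs
import Literature.NumberTheory.EllipticCurves.PAdicLFunctionQuadraticTwistBirchProofs
import Literature.NumberTheory.EllipticCurves.PAdicBSDInterpolationProofs
import Summits.BirchSwinnertonDyer.BirchSwinnertonDyer.Theorems.TwoAdicConverseLambdaHalfTwistDescent
import Literature.NumberTheory.EllipticCurves.SkinnerUrban2014.ShaOrderOfMainConjectureProofs
import Summits.BirchSwinnertonDyer.Rank1Residual.Supersingular.MazurTateReduction
import Summits.BirchSwinnertonDyer.BirchSwinnertonDyer.Theorems.ByReductionTypeAtTwoOrdIsogenyRescale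
import HarnessLib

/-!
# Cell bsd-rank2, seat p2 GEN 46 — THE ANALYTIC SIDE AT THE PRIME `2` ON THE GEN-45 ANCHOR CLASSES:
# Mazur's main conjecture at `p = 2` for the anchor AND FOR EVERY SILENT MEMBER OF ITS INFINITE CLASS, `λ^an = λ^alg`,
# `μ^an = μ^alg = 0`, `ord_{T=0} L₂(E,T) = rank E(ℚ)` EXACTLY on the planted-zeros door, and the `2`-part of BSD at the
# rank-`0` members — from ONE finite `2`-adic Riemann sum of the anchor

GEN 45 (`MuZeroAnchorAtTwo{Anchor,Member,Planting,PlantedDoor}`) settled the ALGEBRAIC Iwasawa invariants at `2` on explicit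
infinite classes: for an ANCHOR `A` (rank `0`, good ordinary at `2`, `A(ℚ)[2] = 0`, odd Tamagawa product,
`#Sel_{2^∞}(A/ℚ) = 2^s`, `#Ã(𝔽₂)[2^∞] = 2^a`, `rank A^{(2)}(ℚ) ≥ k := 2a + s`) one has `char_Λ X₂(A/ℚ_∞) = ((T+2)^k)`, `μ = 0`,
`λ = k` (PRINT: Greenberg 1999 Thm 4.1 at `2`), and for every SILENT member `E = A^{(d)}` (`d > 0` squarefree, `d ≡ 1 (4)`,
`(d, N_A) = 1`, `#Ã(𝔽_ℓ)` odd for `ℓ ∣ d`) `μ(X₂(E)) = 0`, `λ(X₂(E)) = k` (PRINT: Matsuno 2008 Thm 5.1), with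
`char X₂(E) = (T^r (T+2)^{k-r})` and `rank E(ℚ) = r` on the planted-zeros door (`r` points on `E`, `k - r` on `E^{(2)}`).

THIS FILE adds the ANALYTIC side: the `2`-adic `L`-function `L₂(f, α, T)` of Mazur–Swinnerton-Dyer (tree: `padicLFunction f α`,
`α = unitRoot W 2`; INTEGRAL at `2` by the tree theorem `exists_iwasawaToPowerSeries_eq_padicLFunction_two_auto`). The ONLY new
input is a finite certificate (CERT-AN, one `2`-adic Riemann sum of the anchor's modular symbols):

* `RiemannSumCertAtTwo A k n`: `‖RS(k, n)‖₂ = 1` for the newform `f` of `A` (`RS = padicLRiemannSum f α k n`, the level-`n` Riemann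
  sum of `c_k = ∫ binom(log_γ x / log_γ γ… , k) dμ_{f,α}`, `γ = 5`); with the tree's truncation bound `norm_padicLCoeff_eq_of_lt`
  (`‖μ_{f,α}‖ ≤ 2` is the tree theorem `norm_msdMeasure_two_le_two_auto`) and `2^{1 + v₂(k!)} < 2^n` it gives `‖c_k‖₂ = 1`, whence
  (§2, `analyticShapeAtTwo_of_cert`) the integral lift `L ∈ Λ = ℤ₂⟦T⟧` of `L₂(f_A, α)` has a UNIT coefficient in degree `k`:
  `L mod 2 ≠ 0` and `λ(L) ≤ k` (`AnalyticShapeAtTwo A k`). For the GEN-45 anchors: `k = 2`, `n = 3` (single anchors) and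
  `k = 4`, `n = 5` (double anchors), `cert_bound_two_three` / `cert_bound_four_five`.

THEOREMS (modulo the displayed PRINT facts, hypotheses, never asserted: `h41` = Greenberg 1999 Thm 4.1 at `2`
`thm41_charValue_rankZero_anyPrime`; `hKato` = Kato 2004 Thm 17.4 (1)(2) at `2` `kato_divisibility_allPrimes · 2`; `hAU` = the
period-unit fact at `2` `realPeriodRat_eq_unit_mul_plusPeriod_two` (Abbes–Ullmo Thm A + Edixhoven); `h51` = Matsuno 2008 Thm 5.1
`matsuno2008_mu_lambda_quadraticTwist_two`; `hmod` = modularity as parametrisation data `nonempty_modularParametrizationData`):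

* §1 `Λ`-algebra, THE PINCH: `C(p^n)·L = P·h`, `P mod p ≠ 0`, `L mod p ≠ 0`, `λ(L) ≤ λ(P)` ⟹ `L = P·u`, `u ∈ Λˣ`
  (`eq_mul_unit_of_C_pow_mul_eq_mul`); without `L mod p ≠ 0`: `L = C(p^{μ(L)})·P·u` (`eq_C_pow_mu_mul_unit_of_C_pow_mul_eq_mul`).
* §3 `anchor_lift_eq_X_add_two_pow_mul_unit`: anchor package + `h41` + `hKato` (at `A`) + CERT-AN ⟹ the integral lift of
  `L₂(f_A, α)` is `(T+2)^k · u`, `u ∈ Λˣ` (`λ^an = k = λ^alg`, `μ^an = 0 = μ^alg`, all `2`-adic zeros at `T = -2`, the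
  quadratic character of `Γ`); `mazurMainConjecture_two_of_anchor`: + `hAU` + `E[2]` irreducible ⟹ `MazurMainConjecture A 2`
  (Néron normalisation; the tree's typed missing input `Rank1ResidualX1Defs.MazurMainConjecture`) ∧ `μ(X₂(A)) = 0`:
  THE CYCLOTOMIC MAIN CONJECTURE AT THE PRIME `2` on every certified anchor — Kato's divisibility `2^n L₂ ∈ char X₂` pinched to
  an equality by `λ^an ≤ k = λ^alg` and `μ^an = μ^alg = 0`.
* §4 the sibling cell's doors (`TwoAdicTwistConverse.lambdaHalfAtTwo_quadraticTwist_kidaFree`,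
  `analyticRank_eq_zero_of_selmerCorank_eq_zero_quadraticTwist_kidaFree`) with their anchor inputs `hMCW`, `hμW`, `hper₀W`,
  `hper₀A` DISCHARGED: `lambdaHalfAtTwo_twist_of_anchor`, `analyticRank_eq_zero_twist_of_anchor`.
* §5 ALONG THE SILENT CLASS, uniformly from the ONE certificate of the anchor (`member_charIdeal_eq_span_pfree_of_anchor`): for
  every silent member `E`, the canonical lift `L_E ∈ Λ` of `L₂(f_E, α_E)` has `λ(L_E) = k` (Matsuno 2000's mod-`2` twist
  congruence — tree theorem `exists_iwasawa_twist_congr_two` — transports `λ^an`; Thm 5.1 transports `λ^alg`), and for every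
  cyclotomic datum `char X₂(E) = (pfree L_E) ∋ L_E`, `L_E = 2^{μ(L_E)} · f_{X₂(E)} · unit`: the main conjecture for `(E, 2)` holds
  EXACTLY UP TO THE `μ`-PART of `L_E` (`IMC₂(E) ⟺ μ(L_E) = 0`), on the whole infinite class.
* §6 `member_order_padicLFunction_eq_rank_of_anchor`: on the planted-zeros door (`r ≤ k` independent points on `E`, `k - r` on
  `E^{(2)}`): `ord_{T=0} L₂(f_E, α_E, T) = r = rank E(ℚ) = corank Sel_{2^∞}(E/ℚ)` and `Ш(E)[2^∞]` finite — THE ORDER-OF-VANISHING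
  EQUALITY OF `2`-ADIC BSD at rank `r ≤ k` (rank `2` on the 44 GEN-45 door instances), whatever the unknown `μ(L_E)`.
* §7 `μ^an = 0` ALONG THE CLASS WITHOUT A SECOND CERTIFICATE (`member_lift_mu_eq_zero_of_anchor`): Birch's lemma WITH PERIOD SIZE
  `d · (Ω⁺_{f_E})² = c_A² · (Ω⁺_{f_A})²` (tree theorem `exists_iwasawa_twist_congr_two_and_sq`), Pal's `√d · Ω_E = Ω_A` (tree
  theorem, Pal 2012 Thm 3.2) and `hAU` at `A` and at `E` (`A[2]`, `E[2]` irreducible) force `|c_A|₂ = 1`, so `μ(L_E) = μ(L_A') = 0`;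
  hence (`member_mazurMainConjecture_two_of_anchor`) `MazurMainConjecture E 2` FOR EVERY SILENT MEMBER `E` good ordinary at `2`
  with `E[2]` irreducible (+ Kato@2 at `E`): THE MAIN CONJECTURE AT `2` ON AN INFINITE CLASS FROM ONE CERTIFICATE; and
  (`member_bsd_two_part_rank_zero_of_anchor`, via the tree theorem `padicValRat_bsd_rank_zero_of_mazurMainConjecture`) the
  `2`-ADIC VALUATION OF THE BSD FORMULA `v₂(L(E,1)/Ω_E) = v₂(#Ш) + v₂(∏ c_ℓ) - 2 v₂(#E(ℚ)_tors)` at every member with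
  `L(E,1) ≠ 0` and `Ш(E)` finite.
* §8 `member_door_twoAdicBSD_of_anchor`: on the door, all at once — `MazurMainConjecture E 2`, `ord_{T=0} L₂ = r = rank E(ℚ) =
  corank Sel_{2^∞}`, `Ш[2^∞]` finite, and `L_E = T^r (T+2)^{k-r} · u` EXACTLY (`u ∈ Λˣ`); so (`coeff_of_eq_X_pow_mul_X_add_two_pow_mul_unit`)
  the leading Taylor coefficient of `L₂(f_E, α_E, T)` at `T = 0` is `2^{k-r} ×` a `2`-adic unit.
* §9 `member_good_ordinary_irreducible`, `silentClass_mazurMainConjecture_two`, `silentClass_door_twoAdicBSD`,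
  `silentClass_twistRank_ge_rankZero_twoAdicBSD` (rank `E^{(2)}(ℚ) ≥ k` ⟹ `L(E,1) ≠ 0` by the `2`-adic interpolation formula, rank
  `0`, and — given `Ш(E)` finite — the `2`-part of the BSD formula):
  REALIZABLE CORNERS (honesty): on the silent class `Sel₂` is RIGID (`H¹(ℚ_ℓ, A[2]) = 0` at every `ℓ ∣ d`, so
  `Sel₂(E) ≅ Sel₂(A)` and `rank E(ℚ) ≤ dim_{𝔽₂} Ш(A)[2] ≤ s < k = 2a + s`, as `a ≥ 1` at an ordinary anchor): the door is entered
  with `0 ≤ r ≤ dim Ш(A)[2]` (`r = 0` for single anchors, `r ≤ 2` for double anchors — the 44 GEN-45 instances have `r = 2`); the corner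
  `r = k` is never realized on this anchor supply and is deliberately NOT stated as a theorem. the per-member hypotheses (good ordinary at `2`,
  `E[2]` irreducible) are INHERITED from the anchor (`a₂(E) = (2|d)·a₂(A)`, `E[2] ≅ A[2]`): the main conjecture at `2` for every
  member of the silent class with no hypothesis on the member beyond membership (and Kato@2 at `E`, PRINT).

B1-honesty: every conclusion is Iwasawa-theoretic / `2`-adic (`X₂`, `L₂`, `Sel_{2^∞}`, Mordell–Weil rank); nothing is claimed about
the complex analytic rank beyond the sibling's rank-`0` converse (§4).

References: K. Kato, Astérisque 295 (2004), Thm. 17.4 (p. 273) [Kato2004Asterisque]; B. Mazur, J. Tate, J. Teitelbaum, Invent.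
Math. 84 (1986), §I.10–I.13 [MazurTateTeitelbaum1986Invent]; R. Greenberg, LNM 1716 (1999), Thm. 4.1 (p. 102) [GreenbergLNM1716];
K. Matsuno, J. Number Theory 84 (2000), Thm. 3.1, Lemmas 3.2–3.3 (pp. 86–88) [Matsuno2000]; K. Matsuno, Int. J. Number Theory 4
(2008), Thm. 5.1 (p. 416) [Matsuno2008]; A. Abbes, E. Ullmo, Compositio Math. 103 (1996), Thm. A [AbbesUllmo1996]; A. Pál,
Int. J. Number Theory 8 (2012), Thm. 3.2, Prop. 2.5 [Pal2012]; W. Stein, C. Wuthrich, Math. Comp. 82 (2013), §3 [SteinWuthrich2013];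
F. Castella, G. Grossi, C. Skinner (2025), Introduction (MC) [CastellaGrossiSkinner2025]; L. Washington, GTM 83 (1997), §7.1,
§13.1 [Washington1997]; J. H. Silverman, GTM 106 (2009), X.2, X.5 [SilvermanAEC2009].
-/

-- LANDING NOTE (star-p1 GEN 21, 2026-08-29): p2 GEN 46's kernel `HOME/p2/g46/lean/AnalyticAnchorAtTwo.lean` (sha256 858e8b3a…, 1241 lines)
-- split for the 400-line rule into five files: Rank2/AnalyticAnchorAtTwoCert (§1–§2) → …Anchor (§3–§4) → …Member (§5–§6) → …ClassIMC (§7) → Rank2/AnalyticAnchorAtTwo (§8–§9).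
-- THIS FILE = part 1/5 (source lines 121–316); text otherwise verbatim.

set_option linter.dupNamespace false
set_option autoImplicit false

noncomputable section

open scoped Classical MatrixGroups ModularForm

open CongruenceSubgroup NumberField IsDedekindDomain Rat.HeightOneSpectrum WeierstrassCurve
  Literature.NumberTheory.EllipticCurves
  Literature.NumberTheory.EllipticCurves.ModularForms
  Literature.NumberTheory.EllipticCurves.IwasawaAlgebra
  Literature.NumberTheory.EllipticCurves.Rank1Residual
  Literature.NumberTheory.EllipticCurves.Rank1Residual.Typed
  Literature.NumberTheory.EllipticCurves.Greenberg1999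
  Summit.BirchSwinnertonDyer.BirchSwinnertonDyer.Theorems.Rank1ResidualX1Defs
  Summit.BirchSwinnertonDyer.BirchSwinnertonDyer.Theorems.TwoAdicTwistConverse
  Summit.BirchSwinnertonDyer.Rank1Residual.X1.MuLambda
  Summit.BirchSwinnertonDyer.Rank1Residual.X1.MuPart
  Summit.BirchSwinnertonDyer.Rank1Residual.X1.ParitySqueeze
  Summit.BirchSwinnertonDyer.Rank1Residual.X5
  Summit.BirchSwinnertonDyer.Rank1Residual.X5.O1
  Literature.NumberTheory.EllipticCurves.PadicIntSeries

open Summit.BirchSwinnertonDyer.Rank1Residual.Supersingular (red_ne_zero_of_mu_eq_zero)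
open Summit.BirchSwinnertonDyer.BirchSwinnertonDyer.Theorems.IsogenyMuShift (iwasawaToPowerSeries_C)

namespace Summit.BirchSwinnertonDyer.Rank2

/-! ### §1. `Λ`-algebra: unit coefficients, and the pinch -/

section Algebra

variable {p : ℕ} [Fact p.Prime]

-- (dedup) `iwasawaToPowerSeries_C` is the tree's declaration of the same name/statement (imported; see LANDING NOTE).

-- (dedup) `coeff_iwasawaToPowerSeries` is the tree's declaration of the same name/statement (imported; see LANDING NOTE).

/-- A power series over `ℤ_p` with a UNIT coefficient in degree `k` is nonzero mod `p` and has `λ ≤ k` (Washington §7.1: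
with `μ = 0`, `λ` is the index of the first unit coefficient). [cite: Washington1997, §7.1] -/
theorem red_ne_zero_and_lam_le_of_isUnit_coeff {L : IwasawaAlgebra p} {k : ℕ}
    (hk : IsUnit (PowerSeries.coeff k L)) : red L ≠ 0 ∧ lam L ≤ k := by
  have hc : PowerSeries.coeff k (red L) ≠ 0 := by
    rw [PowerSeries.coeff_map]
    exact (hk.map (IsLocalRing.residue ℤ_[p])).ne_zero
  have hred : red L ≠ 0 := fun h0 => hc (by rw [h0, map_zero])
  refine ⟨hred, ?_⟩
  obtain ⟨-, hpf⟩ := mu_eq_and_pfree_eq (g := L) (a := 0) hred (by rw [pow_zero, map_one, one_mul])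
  show (red (pfree L)).order.toNat ≤ k
  rw [hpf]
  exact ENat.toNat_le_of_le_coe (PowerSeries.order_le k hc)

/-- **THE PINCH (unit form).** In `Λ = ℤ_p⟦T⟧`: if `C(p^n) · L = P · h` with `P ≢ 0`, `L ≢ 0 (mod p)` and `λ(L) ≤ λ(P)`, then
`L = P · u` for a unit `u` (`μ`: `n = μ(h)`; `λ`: `λ(L) = λ(P) + λ(h)` forces `λ(h) = 0`; so `h = p^n ·(unit)` and `p^n` cancels).
This is how Kato's divisibility `char X ∋ p^n · L_p` becomes the EQUALITY `(L_p) = char X` once `λ^an ≤ λ^alg` and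
`μ^an = μ^alg = 0` are known. [cite: Washington1997, §7.1, §13.1] -/
theorem eq_mul_unit_of_C_pow_mul_eq_mul {P L h : IwasawaAlgebra p} {n : ℕ}
    (hP : red P ≠ 0) (hL : red L ≠ 0)
    (heq : PowerSeries.C ((p : ℤ_[p]) ^ n) * L = P * h) (hlam : lam L ≤ lam P) :
    ∃ u : (IwasawaAlgebra p)ˣ, L = P * u := by
  have hP0 : P ≠ 0 := by rintro rfl; exact hP (map_zero _)
  have hL0 : L ≠ 0 := by rintro rfl; exact hL (map_zero _)
  have hCL0 : PowerSeries.C ((p : ℤ_[p]) ^ n) * L ≠ 0 := mul_ne_zero (C_pow_ne_zero n) hL0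
  have hh0 : h ≠ 0 := by rintro rfl; rw [mul_zero] at heq; exact hCL0 heq
  have hμCL : mu (PowerSeries.C ((p : ℤ_[p]) ^ n) * L) = n := (mu_eq_and_pfree_eq hL rfl).1
  have hlamCL : lam (PowerSeries.C ((p : ℤ_[p]) ^ n) * L) = lam L := lam_C_pow_mul n hL0
  have hμP : mu P = 0 := mu_eq_zero_of_red_ne_zero hP
  have hμh : mu h = n := by
    have hm := congrArg mu heq
    rw [hμCL, mu_mul hP0 hh0, hμP, zero_add] at hm
    exact hm.symm
  have hlamh : lam h = 0 := by
    have hl := congrArg lam heq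
    rw [hlamCL, lam_mul hP0 hh0] at hl
    omega
  -- `h = C(p^n) · pfree h` with `pfree h` a unit
  have hfac : h = PowerSeries.C ((p : ℤ_[p]) ^ n) * pfree h := by
    have h1 := eq_C_pow_mu_mul_pfree h
    rw [hμh] at h1
    exact h1
  have hlampf : lam (pfree h) = 0 := by
    have hl := lam_C_pow_mul n (pfree_ne_zero hh0)
    rw [← hfac] at hl
    rw [← hl, hlamh]
  have hunit : IsUnit (pfree h) :=
    (isUnit_iff_mu_eq_zero_and_lam_eq_zero _).mpr
      ⟨pfree_ne_zero hh0, mu_eq_zero_of_red_ne_zero (red_pfree_ne_zero hh0), hlampf⟩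
  obtain ⟨u, hu⟩ := hunit
  refine ⟨u, mul_left_cancel₀ (C_pow_ne_zero (p := p) n) ?_⟩
  rw [heq, hfac, hu]; ring

/-- **THE PINCH (general form).** Without `L ≢ 0 (mod p)`: if `C(p^n) · L = P · h`, `P ≢ 0 (mod p)`, `L ≠ 0` and
`λ(L) ≤ λ(P)`, then `L = C(p^{μ(L)}) · P · u` for a unit `u` — `(L) = (p^{μ(L)}) · (P)`: the divisibility `P ∣ p^n L` is an
equality of ideals UP TO THE `μ`-PART of `L`. [cite: Washington1997, §7.1, §13.1] -/
theorem eq_C_pow_mu_mul_unit_of_C_pow_mul_eq_mul {P L h : IwasawaAlgebra p} {n : ℕ}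
    (hP : red P ≠ 0) (hL0 : L ≠ 0)
    (heq : PowerSeries.C ((p : ℤ_[p]) ^ n) * L = P * h) (hlam : lam L ≤ lam P) :
    ∃ u : (IwasawaAlgebra p)ˣ, L = PowerSeries.C ((p : ℤ_[p]) ^ mu L) * P * u := by
  have hfacL := eq_C_pow_mu_mul_pfree L
  have hredL : red (pfree L) ≠ 0 := red_pfree_ne_zero hL0
  have hlamL : lam (pfree L) = lam L := by
    have hl := lam_C_pow_mul (mu L) (pfree_ne_zero hL0)
    rw [← hfacL] at hl
    exact hl.symm
  have heq' : PowerSeries.C ((p : ℤ_[p]) ^ (n + mu L)) * pfree L = P * h := by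
    rw [pow_add, map_mul, mul_assoc, ← hfacL]; exact heq
  obtain ⟨u, hu⟩ := eq_mul_unit_of_C_pow_mul_eq_mul hP hredL heq' (by rw [hlamL]; exact hlam)
  refine ⟨u, ?_⟩
  calc L = PowerSeries.C ((p : ℤ_[p]) ^ mu L) * pfree L := hfacL
    _ = PowerSeries.C ((p : ℤ_[p]) ^ mu L) * P * u := by rw [hu, mul_assoc]

-- (dedup) `red_ne_zero_of_mu_eq_zero` is the tree's declaration of the same name/statement (imported; see LANDING NOTE).

/-- `ord_T (C c · g · u) = ord_T g` for `c ≠ 0` and a unit `u` (`Λ` is a domain). [folklore] -/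
theorem order_C_mul_mul_unit {c : ℤ_[p]} (hc : c ≠ 0) (g : IwasawaAlgebra p) (u : (IwasawaAlgebra p)ˣ) :
    (PowerSeries.C c * g * (u : IwasawaAlgebra p)).order = g.order := by
  have hC : (PowerSeries.C c : IwasawaAlgebra p).order = 0 := by
    refine le_antisymm (PowerSeries.order_le 0 (by simpa using hc)) bot_le
  have hu : (u : IwasawaAlgebra p).order = 0 := by
    refine le_antisymm (PowerSeries.order_le 0 ?_) bot_le
    rw [PowerSeries.coeff_zero_eq_constantCoeff]
    exact (PowerSeries.isUnit_iff_constantCoeff.mp u.isUnit).ne_zero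
  rw [PowerSeries.order_mul, PowerSeries.order_mul, hC, hu, zero_add, add_zero]

end Algebra

/-! ### §2. The `2`-adic analytic certificate: one Riemann sum ⟹ a unit coefficient of the integral lift -/

section Certificate

variable (A : WeierstrassCurve ℚ) [A.IsElliptic] [A.IsGloballyMinimal]

/-- **ANALYTIC SHAPE AT `2` (the conclusion of the certificate).** For every newform `f` of `A`: the `2`-adic `L`-function
`L₂(f, α, T)` (`α = unitRoot A 2`) has an integral lift `L ∈ Λ = ℤ₂⟦T⟧` with `L ≢ 0 (mod 2)` (so `μ(L) = 0`) and `λ(L) ≤ k`.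
[cite: MazurTateTeitelbaum1986Invent, §I.10–I.13] -/
def AnalyticShapeAtTwo (k : ℕ) : Prop :=
  ∀ {N : ℕ} [NeZero N] (f : CuspForm (Gamma0 N) 2), IsNewformOf A f →
    ∃ L : IwasawaAlgebra 2, iwasawaToPowerSeries 2 L = padicLFunction f (unitRoot A 2 : ℚ_[2]) ∧
      red L ≠ 0 ∧ lam L ≤ k

/-- **CERT-AN (finite, per curve): the level-`n` `2`-adic Riemann sum of the `k`-th Mazur–Tate–Teitelbaum coefficient is a
`2`-adic unit**, `‖padicLRiemannSum f α k n‖₂ = 1`, for the newform `f` of `A` — a finite signed sum of `2^{n+1}` plus modular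
symbols `[a/2^{n+2}]⁺_f ∈ ℤ[1/2]·(bounded)` weighted by `α^{-j}` and binomial coefficients; checked by exact modular-symbol
arithmetic (kit job of the cell, Stein–Wuthrich numerical symbols with denominator control, eclib cross-check).
[cite: SteinWuthrich2013, §3] [cite: MazurTateTeitelbaum1986Invent, §I.11] -/
def RiemannSumCertAtTwo (k n : ℕ) : Prop :=
  ∀ {N : ℕ} [NeZero N] (f : CuspForm (Gamma0 N) 2), IsNewformOf A f →
    ‖padicLRiemannSum f (unitRoot A 2 : ℚ_[2]) k n‖ = 1

variable {A}

/-- **CERT-AN ⟹ ANALYTIC SHAPE.** If `A` is good ordinary at `2`, `2 · ‖k!‖₂⁻¹ · 2^{-n} < 1` and `‖RS(k, n)‖₂ = 1`, then the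
integral lift of `L₂(f_A, α)` is nonzero mod `2` with `λ ≤ k`: the tree's truncation estimate `norm_padicLCoeff_eq_of_lt` (measure
bound `‖μ_{f,α}‖ ≤ 2`, `norm_msdMeasure_two_le_two_auto`; distribution relation `msdMeasure_distribution_of_isNewformOf`) gives
`‖c_k‖₂ = ‖RS(k,n)‖₂ = 1`, i.e. the `k`-th coefficient of the lift (INT2-AUTO) is a `2`-adic unit.
[cite: MazurTateTeitelbaum1986Invent, §I.11–I.13] [cite: SteinWuthrich2013, §3] -/
theorem analyticShapeAtTwo_of_cert (hordA : IsOrdinaryAt A 2) {k n : ℕ}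
    (hn : (2 : ℝ) / ‖((k.factorial : ℕ) : ℚ_[2])‖ * ((2 : ℕ) : ℝ) ^ (-n : ℤ) < 1)
    (hcert : RiemannSumCertAtTwo A k n) : AnalyticShapeAtTwo A k := by
  intro N _ f hf
  obtain ⟨hαeq, hαu, -⟩ := unitRoot_coe_spec (W := A) hordA
  have hpN : ¬ 2 ∣ N := not_dvd_level_of_isNewformOf hf hordA.1
  have hap : cuspCoeff f 2 = ((A.frobeniusTrace 2 : ℤ) : ℂ) :=
    cuspCoeff_eq_frobeniusTrace_of_isNewformOf_holds hf hordA.1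
  have hα : ‖(unitRoot A 2 : ℚ_[2])⁻¹‖ ≤ 1 := by rw [norm_inv, hαu, inv_one]
  have hC := norm_msdMeasure_two_le_two_auto hf.1
    (cuspCoeff_im_eq_zero_of_coeffField_eq_bot hf.coeffField_eq_bot) hpN hap hα hαeq
  have h1 : ‖padicLRiemannSum f (unitRoot A 2 : ℚ_[2]) k n‖ = 1 := hcert f hf
  have hlt : (2 : ℝ) / ‖((k.factorial : ℕ) : ℚ_[2])‖ * ((2 : ℕ) : ℝ) ^ (-n : ℤ) <
      ‖padicLRiemannSum f (unitRoot A 2 : ℚ_[2]) k n‖ := by rw [h1]; exact hn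
  obtain ⟨hnorm, -⟩ :=
    norm_padicLCoeff_eq_of_lt (msdMeasure_distribution_of_isNewformOf hordA hf) (by norm_num) hC hlt
  rw [h1] at hnorm
  obtain ⟨L, hL⟩ := exists_iwasawaToPowerSeries_eq_padicLFunction_two_auto hordA hf
  refine ⟨L, hL, red_ne_zero_and_lam_le_of_isUnit_coeff (k := k) ?_⟩
  have hcoe : ((PowerSeries.coeff k L : ℤ_[2]) : ℚ_[2]) = padicLCoeff f (unitRoot A 2 : ℚ_[2]) k := by
    rw [← coeff_iwasawaToPowerSeries, hL, coeff_padicLFunction]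
  rw [PadicInt.isUnit_iff, PadicInt.norm_def, hcoe, hnorm]

/-- `‖3‖₂ = 1`. [folklore] -/
theorem norm_three_padic_two : ‖((3 : ℕ) : ℚ_[2])‖ = 1 :=
  Padic.norm_natCast_eq_one_iff.mpr (by norm_num)

/-- The certificate bound at `k = 2`, `n = 3`: `2 · ‖2!‖₂⁻¹ · 2⁻³ = 1/2 < 1` (single anchors). [folklore] -/
theorem cert_bound_two_three :
    (2 : ℝ) / ‖((Nat.factorial 2 : ℕ) : ℚ_[2])‖ * ((2 : ℕ) : ℝ) ^ (-(3 : ℕ) : ℤ) < 1 := by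
  have h2 : ‖((Nat.factorial 2 : ℕ) : ℚ_[2])‖ = (2 : ℝ)⁻¹ := by
    rw [Nat.factorial_two]
    exact_mod_cast Padic.norm_p (p := 2)
  rw [h2, show (-(3 : ℕ) : ℤ) = -3 by norm_num, zpow_neg, zpow_ofNat]
  norm_num

/-- The certificate bound at `k = 4`, `n = 5`: `2 · ‖4!‖₂⁻¹ · 2⁻⁵ = 1/2 < 1` (double anchors). [folklore] -/
theorem cert_bound_four_five :
    (2 : ℝ) / ‖((Nat.factorial 4 : ℕ) : ℚ_[2])‖ * ((2 : ℕ) : ℝ) ^ (-(5 : ℕ) : ℤ) < 1 := by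
  have h24 : ‖((Nat.factorial 4 : ℕ) : ℚ_[2])‖ = ((2 : ℝ) ^ 3)⁻¹ := by
    have hfac : (Nat.factorial 4 : ℕ) = 2 ^ 3 * 3 := by decide
    rw [hfac, Nat.cast_mul, Nat.cast_pow, norm_mul, norm_pow, norm_three_padic_two, mul_one]
    have h2 : ‖((2 : ℕ) : ℚ_[2])‖ = (2 : ℝ)⁻¹ := by exact_mod_cast Padic.norm_p (p := 2)
    rw [h2, inv_pow]
  rw [h24, show (-(5 : ℕ) : ℤ) = -5 by norm_num, zpow_neg, zpow_ofNat]
  norm_num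

/-- The certificate at `(k, n) = (2, 3)` gives the analytic shape with `λ ≤ 2`. -/
theorem analyticShapeAtTwo_two_of_cert (hordA : IsOrdinaryAt A 2) (hcert : RiemannSumCertAtTwo A 2 3) :
    AnalyticShapeAtTwo A 2 :=
  analyticShapeAtTwo_of_cert hordA cert_bound_two_three hcert

/-- The certificate at `(k, n) = (4, 5)` gives the analytic shape with `λ ≤ 4`. -/
theorem analyticShapeAtTwo_four_of_cert (hordA : IsOrdinaryAt A 2) (hcert : RiemannSumCertAtTwo A 4 5) :
    AnalyticShapeAtTwo A 4 :=
  analyticShapeAtTwo_of_cert hordA cert_bound_four_five hcert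

end Certificate

end Summit.BirchSwinnertonDyer.Rank2

end
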